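import Literature.NumberTheory.Automorphic.AutomorphicQuotientKernelNoncompact
import HarnessLib

/-!
# The Hilbert–Schmidt norm of `R(f)` as the integral of the kernel of `f ⋆ f^*` over the
# diagonal, on a non-compact quotient: `Σ_i ‖R(f) e_i‖² = c⁻¹ ∫_X K_{f ⋆ f^*}(x, x) dμ(x)` in `[0, ∞]`
(Gelbart, *Automorphic forms on adele groups* (1975), (9.11), p. 117 and (9.20), p. 120, Prop. 9.6;
Bump (1997), Thm. 2.3.2)

Topic `NumberTheory/Automorphic`; theorems only (no definition, no named fact, no instance
visible to importers). Continuation of `AutomorphicQuotientKernelConvolution` (compact quotients)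
and `AutomorphicQuotientKernelNoncompact` (bounded sections, the Hilbert–Schmidt identity
`Σ_i ‖R(f) e_i‖² = c⁻² ∬ |K_f|²` without compactness). A brick of the inline (D-0026)
decomposition of `Literature.NumberTheory.Automorphic.jacquetLanglands_transfer_exists`
(`JacquetLanglandsParts`; Gelbart Thm. 10.5 (i)) on the `GL₂` side of the trace-formula comparison,
where the quotient `GL₂(𝔸) ⧸ A_G GL₂(K)` is not compact: the starting point of the geometric side
of (10.15) is Gelbart's (9.11), "`tr R(f) = ∫_{Γ\G} K(x, x) dx` … at least when `f = f₁ * f₂`",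
read for `f ⋆ f^*`, i.e. `‖R(f)‖²_{HS} = c⁻¹ ∫_X K_{f ⋆ f^*}(x, x) dμ(x)`. On a non-compact quotient
both sides may be infinite (they are finite exactly when `R(f)` is Hilbert–Schmidt, e.g. on the
cuspidal functions of Prop. 9.6 / `SupercuspTypeCuspidalImage`), and the identity is proved here as
an identity in `[0, ∞]`:

* `exists_norm_quotientKernel_le_of_right` — the sections `x ↦ K_f(x, y)` in the *first* variable
  are bounded too (`K_f(x, y) = \overline{K_{f^*}(y, x)}`, `quotientKernel_mulStar`, and the
  second-variable bound `exists_norm_quotientKernel_le_of_left` of the previous layer).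
* `integral_cosetKernel_mul_quotientKernel'` — **composition of kernels without compactness**:
  `∫_X K_{f₁}(x̃, z) K_{f₂}(z, y) dμ(z) = c • K_{f₁ ⋆ f₂}(x̃, y)` for a finite invariant `μ`
  (the compact-quotient proof of `AutomorphicQuotientKernelConvolution` verbatim, the integrability
  of `z ↦ K_{f₂}(z, y)` now coming from the bounded section).
* `integral_norm_sq_quotientKernel_eq_smul_diag` — **`∫_X |K_f(x, y)|² dμ(y) = c • K_{f ⋆ f^*}(x, x)`
  for every `x`**; hence `K_{f ⋆ f^*}(x, x)` is real and non-negative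
  (`quotientKernel_mulConv_mulStar_diag_eq`).
* `lintegral_lintegral_enorm_sq_quotientKernel_eq` — `∬ ‖K_f‖ₑ² dμ dμ = c · ∫⁻_X re K_{f ⋆ f^*}(x, x) dμ`
  in `[0, ∞]`.
* `AdelicGroupData.tsum_enorm_sq_integratedOperator_rightRegular_eq_lintegral_diagonal` — for an
  adelic group datum with `G(𝔸_K)` locally compact second countable Hausdorff, `H = A_G · G(K)`
  closed and unimodular, an automorphic measure `μ`, an inversion-invariant Haar measure `ν` and
  `f ∈ C_c(G(𝔸_K))`: **`Σ'_i ‖R(f) e_i‖ₑ² = ofReal (c⁻¹) · ∫⁻_X re K_{f ⋆ f^*}(x, x) dμ(x)`** for every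
  countable Hilbert basis of `L²(X, μ)` — Gelbart's (9.11) in Hilbert–Schmidt form on a possibly
  non-compact quotient (the compact case, in `ℂ`, is
  `hasSum_norm_sq_integratedOperator_rightRegular_eq_diagonal` of `AutomorphicQuotientKernelConvolution`).

## References

* S. Gelbart, *Automorphic forms on adele groups*, Ann. of Math. Studies 83 (1975), (9.7), (9.11)
  (p. 117), (9.20) (p. 120), Prop. 9.6 (p. 122), Lemma 10.6 [Gelbart1975].
* D. Bump, *Automorphic Forms and Representations* (1997), §2.3, Thm. 2.3.2 [Bump1997].
-/

noncomputable section

open MeasureTheory Measure Set Filter Topology CompactlySupported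
open Literature.MeasureTheory.Group
open scoped ENNReal NNReal Pointwise ComplexConjugate

namespace Literature.NumberTheory.Automorphic

-- the coset space carries the Borel σ-algebra supplied by the user, not the quotient σ-algebra
attribute [-instance] Quotient.instMeasurableSpace QuotientGroup.measurableSpace

section Diagonal

variable {G : Type*} [Group G] [TopologicalSpace G] [IsTopologicalGroup G] [LocallyCompactSpace G]
  [SecondCountableTopology G] [T2Space G] [MeasurableSpace G] [BorelSpace G]
  (H : Subgroup G) [hH : IsClosed (H : Set G)]
  (ρ : Measure H) [ρ.IsMulLeftInvariant] [ρ.IsMulRightInvariant] [ρ.IsInvInvariant] [SFinite ρ]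
  [IsFiniteMeasureOnCompacts ρ]
  [MeasurableSpace (G ⧸ H)] [BorelSpace (G ⧸ H)]
  (μ : Measure (G ⧸ H)) [SMulInvariantMeasure G (G ⧸ H) μ] [IsFiniteMeasureOnCompacts μ]
  (ν : Measure G) [IsHaarMeasure ν] [ν.IsInvInvariant]
  {𝕜 : Type*} [RCLike 𝕜]

omit [SMulInvariantMeasure G (G ⧸ H) μ] [IsFiniteMeasureOnCompacts μ] [IsHaarMeasure ν]
  [ν.IsInvInvariant] in
/-- **The sections `x ↦ K_f(x, y)` of the kernel in the first variable are bounded** (for `ρ`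
two-sided and inversion invariant): `‖K_f(x, y)‖ = ‖K_{f^*}(y, x)‖` (`quotientKernel_mulStar`) and
`exists_norm_quotientKernel_le_of_left` for `f^*`. [cite: Gelbart1975, (9.20)] -/
theorem exists_norm_quotientKernel_le_of_right
    {f : G → 𝕜} (hf : Continuous f) (hfs : HasCompactSupport f) (y : G ⧸ H) :
    ∃ C : ℝ, ∀ x : G ⧸ H, ‖quotientKernel H ρ f x y‖ ≤ C := by
  obtain ⟨C, hC⟩ := exists_norm_quotientKernel_le_of_left H ρ (continuous_mulStar hf)
    (hasCompactSupport_mulStar hfs) y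
  refine ⟨C, fun x => ?_⟩
  rw [← RCLike.norm_conj, ← quotientKernel_mulStar H ρ f y x]
  exact hC x

/-- **Composition of kernels, without compactness** (the kernel of `R(f₁) R(f₂) = R(f₁ ⋆ f₂)`;
Gelbart (1975), §9). For `X = G ⧸ H` with a finite invariant measure `μ` (`G`, `H` unimodular),
`f₁, f₂ ∈ C_c(G)`, every lift `x̃` and every `y ∈ X`:
`∫_X K_{f₁}(x̃, z) K_{f₂}(z, y) dμ(z) = c • K_{f₁ ⋆ f₂}(x̃, y)`, `c = unfoldingConstant H ρ μ ν`. The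
proof of `integral_cosetKernel_mul_quotientKernel` (`AutomorphicQuotientKernelConvolution`) applies
verbatim, the test function `z ↦ K_{f₂}(z, y)` being bounded by
`exists_norm_quotientKernel_le_of_right` instead of by compactness. [cite: Gelbart1975, (9.7) and (9.11)] -/
theorem integral_cosetKernel_mul_quotientKernel' [IsFiniteMeasure μ]
    {f₁ f₂ : G → 𝕜} (hf₁ : Continuous f₁) (hfs₁ : HasCompactSupport f₁) (hf₂ : Continuous f₂)
    (hfs₂ : HasCompactSupport f₂) (x₀ : G) (y : G ⧸ H) :
    ∫ z, cosetKernel H ρ f₁ x₀ z * quotientKernel H ρ f₂ z y ∂μ =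
      (unfoldingConstant H ρ μ ν) • cosetKernel H ρ (mulConv ν f₁ f₂) x₀ y := by
  induction y using QuotientGroup.induction_on with
  | H y₀ =>
    -- the test function `φ = K_{f₂}(·, y)`
    set φ : G ⧸ H → 𝕜 := fun z => quotientKernel H ρ f₂ z (QuotientGroup.mk y₀) with hφ
    have hφc : Continuous φ :=
      (continuous_uncurry_quotientKernel H ρ hf₂ hfs₂).comp (Continuous.prodMk_left _)
    have hφm : StronglyMeasurable φ := hφc.stronglyMeasurable
    have hφi : Integrable φ μ := by
      obtain ⟨C, hC⟩ := exists_norm_quotientKernel_le_of_right H ρ hf₂ hfs₂ (QuotientGroup.mk y₀)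
      exact (integrable_const C).mono' hφc.aestronglyMeasurable (Eventually.of_forall fun z => hC z)
    -- the kernel formula of the first layer for `f₁` and `φ`
    have h1 := smul_orbitalSmoothing_mk_eq_integral_cosetKernel_smul H ρ μ ν hf₁ hfs₁ hφm hφi x₀
    simp only [smul_eq_mul] at h1
    rw [← h1, orbitalSmoothing_mk_eq_integral H ν f₁ φ x₀]
    congr 1
    -- `∫_G f₁(x̃ g⁻¹) K_{f₂}(gH, y) dν(g) = K_{f₁ ⋆ f₂}(x̃, y)`: substitute back and use Fubini
    rw [cosetKernel_mk]
    have h2 : (fun g : G => f₁ (x₀ * g⁻¹) • φ (QuotientGroup.mk g)) =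
        fun g : G => (fun u : G => ∫ h : H, f₁ u * f₂ (u⁻¹ * x₀ * (h : G)⁻¹ * y₀⁻¹) ∂ρ)
          (x₀ * g⁻¹) := by
      funext g
      simp only [hφ, quotientKernel_mk_mk, smul_eq_mul]
      rw [← integral_const_mul]
      congr 1 with h
      congr 2
      group
    rw [h2]
    have h3 :
        ∫ g, (fun u : G => ∫ h : H, f₁ u * f₂ (u⁻¹ * x₀ * (h : G)⁻¹ * y₀⁻¹) ∂ρ) (x₀ * g⁻¹) ∂ν =
        ∫ u, ∫ h : H, f₁ u * f₂ (u⁻¹ * x₀ * (h : G)⁻¹ * y₀⁻¹) ∂ρ ∂ν := by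
      have e := orbitalSmoothing_mk_eq_integral H ν
        (fun u : G => ∫ h : H, f₁ u * f₂ (u⁻¹ * x₀ * (h : G)⁻¹ * y₀⁻¹) ∂ρ)
        (fun _ : G ⧸ H => (1 : 𝕜)) x₀
      simp only [orbitalSmoothing, smul_eq_mul, mul_one] at e
      exact e.symm
    rw [h3, integral_integral_swap (integrable_mul_comp_conj H ρ ν hf₁ hfs₁ hf₂ hfs₂ x₀ y₀)]
    congr 1 with h
    rw [mulConv_apply]
    congr 1 with u
    congr 1
    group

/-- **`∫_X |K_f(x, y)|² dμ(y) = c • K_{f ⋆ f^*}(x, x)` for every `x`** (finite invariant `μ`;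
`G`, `H` unimodular; `f ∈ C_c(G)`): composition of the kernels of `f` and `f^*` at the diagonal,
`K_{f^*}(y, x) = \overline{K_f(x, y)}`. This is Gelbart's (9.11) at a point, `tr`-free: the
Hilbert–Schmidt density `∫ |K_f(x, ·)|²` is the diagonal value of the kernel of `f ⋆ f^*`.
[cite: Gelbart1975, (9.11)] -/
theorem integral_norm_sq_quotientKernel_eq_smul_diag [IsFiniteMeasure μ] {f : G → 𝕜}
    (hf : Continuous f) (hfs : HasCompactSupport f) (x : G ⧸ H) :
    (((∫ y, ‖quotientKernel H ρ f x y‖ ^ 2 ∂μ : ℝ) : 𝕜)) =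
      (unfoldingConstant H ρ μ ν) • quotientKernel H ρ (mulConv ν f (mulStar f)) x x := by
  induction x using QuotientGroup.induction_on with
  | H x₀ =>
    rw [quotientKernel_mk, quotientKernel_mk,
      ← integral_cosetKernel_mul_quotientKernel' H ρ μ ν hf hfs (continuous_mulStar hf)
        (hasCompactSupport_mulStar hfs) x₀ (QuotientGroup.mk x₀), ← integral_ofReal]
    congr 1 with y
    rw [quotientKernel_mulStar, quotientKernel_mk, RCLike.ofReal_pow, RCLike.mul_conj]

/-- **The diagonal values `K_{f ⋆ f^*}(x, x)` are real and non-negative**: for `c ≠ 0`,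
`K_{f ⋆ f^*}(x, x) = c⁻¹ ∫_X |K_f(x, y)|² dμ(y)` (as an element of `𝕜`). [cite: Gelbart1975, (9.11)] -/
theorem quotientKernel_mulConv_mulStar_diag_eq [IsFiniteMeasure μ]
    (hc : unfoldingConstant H ρ μ ν ≠ 0) {f : G → 𝕜} (hf : Continuous f)
    (hfs : HasCompactSupport f) (x : G ⧸ H) :
    quotientKernel H ρ (mulConv ν f (mulStar f)) x x =
      ((((unfoldingConstant H ρ μ ν : ℝ)⁻¹ * ∫ y, ‖quotientKernel H ρ f x y‖ ^ 2 ∂μ : ℝ) : 𝕜)) := by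
  have h := integral_norm_sq_quotientKernel_eq_smul_diag H ρ μ ν hf hfs x
  rw [NNReal.smul_def, RCLike.real_smul_eq_coe_mul] at h
  have hc' : ((unfoldingConstant H ρ μ ν : ℝ) : 𝕜) ≠ 0 := by exact_mod_cast hc
  rw [RCLike.ofReal_mul, h, ← mul_assoc, RCLike.ofReal_inv, inv_mul_cancel₀ hc', one_mul]

/-- The real part of `K_{f ⋆ f^*}(x, x)` is `c⁻¹ ∫_X |K_f(x, y)|² dμ(y) ≥ 0` (for `c ≠ 0`).
[cite: Gelbart1975, (9.11)] -/
theorem re_quotientKernel_mulConv_mulStar_diag_eq [IsFiniteMeasure μ]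
    (hc : unfoldingConstant H ρ μ ν ≠ 0) {f : G → 𝕜} (hf : Continuous f)
    (hfs : HasCompactSupport f) (x : G ⧸ H) :
    RCLike.re (quotientKernel H ρ (mulConv ν f (mulStar f)) x x) =
      (unfoldingConstant H ρ μ ν : ℝ)⁻¹ * ∫ y, ‖quotientKernel H ρ f x y‖ ^ 2 ∂μ := by
  rw [quotientKernel_mulConv_mulStar_diag_eq H ρ μ ν hc hf hfs x, RCLike.ofReal_re]

/-- **`∬ ‖K_f‖ₑ² dμ dμ = c · ∫⁻_X re K_{f ⋆ f^*}(x, x) dμ(x)` in `[0, ∞]`** (finite invariant `μ`,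
`c ≠ 0`; `G`, `H` unimodular; `f ∈ C_c(G)`): the pointwise identity
`integral_norm_sq_quotientKernel_eq_smul_diag` integrated in `x`, both sides possibly infinite
(Gelbart (1975), (9.11) read for `f ⋆ f^*`: `‖K_f‖²_{L²(X × X)} = c ∫ K_{f ⋆ f^*}(x, x) dx`).
[cite: Gelbart1975, (9.11)] -/
theorem lintegral_lintegral_enorm_sq_quotientKernel_eq [IsFiniteMeasure μ]
    (hc : unfoldingConstant H ρ μ ν ≠ 0) {f : G → 𝕜} (hf : Continuous f)
    (hfs : HasCompactSupport f) :
    ∫⁻ x, ∫⁻ y, ‖quotientKernel H ρ f x y‖ₑ ^ 2 ∂μ ∂μ =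
      (unfoldingConstant H ρ μ ν : ℝ≥0∞) *
        ∫⁻ x, ENNReal.ofReal (RCLike.re (quotientKernel H ρ (mulConv ν f (mulStar f)) x x)) ∂μ := by
  -- measurability of the diagonal of the continuous kernel of `f ⋆ f^*`
  have hfc : Continuous (mulConv ν f (mulStar f)) :=
    continuous_mulConv ν hf hfs (continuous_mulStar hf)
  have hfcs : HasCompactSupport (mulConv ν f (mulStar f)) :=
    hasCompactSupport_mulConv ν hfs (hasCompactSupport_mulStar hfs)
  have hdiag : Measurable fun x : G ⧸ H =>
      ENNReal.ofReal (RCLike.re (quotientKernel H ρ (mulConv ν f (mulStar f)) x x)) := by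
    have hcd : Continuous fun x : G ⧸ H => quotientKernel H ρ (mulConv ν f (mulStar f)) x x :=
      (continuous_uncurry_quotientKernel H ρ hfc hfcs).comp (continuous_id.prodMk continuous_id)
    exact (RCLike.continuous_re.comp hcd).measurable.ennreal_ofReal
  rw [← lintegral_const_mul _ hdiag]
  refine lintegral_congr fun x => ?_
  -- pointwise: `∫⁻ ‖K x y‖ₑ² = ofReal (∫ ‖K x y‖²) = ofReal (c * re K̃(x, x))`
  have hK2 : MemLp (fun y => quotientKernel H ρ f x y) 2 μ :=
    memLp_two_quotientKernel_section H ρ μ hf hfs x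
  have hint : Integrable (fun y => ‖quotientKernel H ρ f x y‖ ^ 2) μ :=
    (memLp_two_iff_integrable_sq_norm hK2.1).1 hK2
  have h1 : ∫⁻ y, ‖quotientKernel H ρ f x y‖ₑ ^ 2 ∂μ =
      ENNReal.ofReal (∫ y, ‖quotientKernel H ρ f x y‖ ^ 2 ∂μ) := by
    rw [ofReal_integral_eq_lintegral_ofReal hint (Eventually.of_forall fun y => sq_nonneg _)]
    refine lintegral_congr fun y => ?_
    rw [ENNReal.ofReal_pow (norm_nonneg _), ofReal_norm]
  rw [h1, re_quotientKernel_mulConv_mulStar_diag_eq H ρ μ ν hc hf hfs x]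
  have hc0 : (0 : ℝ) ≤ (unfoldingConstant H ρ μ ν : ℝ) := NNReal.coe_nonneg _
  have hI0 : 0 ≤ ∫ y, ‖quotientKernel H ρ f x y‖ ^ 2 ∂μ := integral_nonneg fun y => sq_nonneg _
  rw [show (unfoldingConstant H ρ μ ν : ℝ)⁻¹ * ∫ y, ‖quotientKernel H ρ f x y‖ ^ 2 ∂μ =
      (unfoldingConstant H ρ μ ν : ℝ)⁻¹ * ∫ y, ‖quotientKernel H ρ f x y‖ ^ 2 ∂μ from rfl,
    ENNReal.ofReal_mul (inv_nonneg.2 hc0), ← mul_assoc, ENNReal.ofReal_inv_of_pos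
      (lt_of_le_of_ne hc0 (fun h => hc (by exact_mod_cast h.symm))),
    ENNReal.ofReal_coe_nnreal, ENNReal.mul_inv_cancel (by exact_mod_cast hc) ENNReal.coe_ne_top,
    one_mul]

end Diagonal

/-! ### Automorphic quotients: `Σ'_i ‖R(f) e_i‖ₑ² = ofReal (c⁻¹) · ∫⁻_X re K_{f ⋆ f^*}(x, x) dμ(x)` -/

namespace AdelicGroupData

universe u

variable {K : Type} [Field K] [NumberField K] (𝒢 : AdelicGroupData.{u} K)

attribute [local instance] measurableSpaceQuotientForm borelSpaceQuotientForm
  smulInvariantMeasureQuotientForm isFiniteMeasureOnCompactsQuotientForm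

variable (μ : Measure 𝒢.automorphicQuotient) [𝒢.IsAutomorphicMeasure μ]

attribute [local instance] isFiniteMeasureQuotientForm

variable [LocallyCompactSpace 𝒢.Adelic] [SecondCountableTopology 𝒢.Adelic] [T2Space 𝒢.Adelic]
  [MeasurableSpace 𝒢.Adelic] [BorelSpace 𝒢.Adelic]
  [hH : IsClosed (𝒢.quotientSubgroup : Set 𝒢.Adelic)]
  (ρ : Measure 𝒢.quotientSubgroup) [ρ.IsMulLeftInvariant] [ρ.IsMulRightInvariant]
  [ρ.IsInvInvariant] [IsFiniteMeasureOnCompacts ρ] [SFinite ρ]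
  (ν : Measure 𝒢.Adelic) [IsHaarMeasure ν] [ν.IsInvInvariant]

/-- **Gelbart's (9.11) in Hilbert–Schmidt form on a possibly non-compact automorphic quotient:
`Σ'_i ‖R(f) e_i‖ₑ² = ofReal (c⁻¹) · ∫⁻_X re K_{f ⋆ f^*}(x, x) dμ(x)`.** For an adelic group datum
with `G(𝔸_K)` locally compact, second countable and Hausdorff, `H = A_G · G(K)` closed and
unimodular (`ρ ≠ 0` two-sided and inversion invariant, s-finite, finite on compacts), an
automorphic measure `μ`, an inversion-invariant Haar measure `ν` and `f ∈ C_c(G(𝔸_K))`: for every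
countable Hilbert basis `(e_i)` of `L²(X, μ)`, the Hilbert–Schmidt sum of `R(f)` is `c⁻¹` times the
integral over the diagonal of the (continuous, real, non-negative on the diagonal) kernel of
`f ⋆ f^*` — both sides in `[0, ∞]`, finite iff `R(f)` is Hilbert–Schmidt
(`tsum_enorm_sq_integratedOperator_rightRegular_eq` of `AutomorphicQuotientKernelNoncompact` with
`lintegral_lintegral_enorm_sq_quotientKernel_eq`). "`tr R(f) = ∫_{Γ\G} K(x, x) dx` … at least when
`f = f₁ * f₂`" (Gelbart p. 117), read for `f ⋆ f^*`; the compact case in `ℂ` is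
`hasSum_norm_sq_integratedOperator_rightRegular_eq_diagonal`. [cite: Gelbart1975, (9.11) and Prop. 9.6] -/
theorem tsum_enorm_sq_integratedOperator_rightRegular_eq_lintegral_diagonal (hρ : ρ ≠ 0)
    (f : C_c(𝒢.Adelic, ℂ)) {ι : Type*} [Countable ι] (b : HilbertBasis ι ℂ (𝒢.L2 μ)) :
    ∑' i, ‖(𝒢.rightRegular μ).integratedOperator (𝒢.isUnitary_rightRegular μ)
        (𝒢.isStronglyContinuous_rightRegular_holds μ) ν f (b i)‖ₑ ^ 2 =
      ENNReal.ofReal ((unfoldingConstant 𝒢.quotientSubgroup ρ μ ν : ℝ)⁻¹) *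
        ∫⁻ x, ENNReal.ofReal ((quotientKernel 𝒢.quotientSubgroup ρ
          (mulConv ν (f : 𝒢.Adelic → ℂ) (mulStar f)) x x).re) ∂μ := by
  have hc : unfoldingConstant 𝒢.quotientSubgroup ρ μ ν ≠ 0 :=
    (unfoldingConstant_pos 𝒢.quotientSubgroup ρ μ ν (IsAutomorphicMeasure.ne_zero 𝒢 μ) hρ).ne'
  have hcpos : (0 : ℝ) < (unfoldingConstant 𝒢.quotientSubgroup ρ μ ν : ℝ) :=
    NNReal.coe_pos.2 (pos_iff_ne_zero.2 hc)
  have h2 : ∫⁻ x, ∫⁻ y, ‖quotientKernel 𝒢.quotientSubgroup ρ (f : 𝒢.Adelic → ℂ) x y‖ₑ ^ 2 ∂μ ∂μ =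
      (unfoldingConstant 𝒢.quotientSubgroup ρ μ ν : ℝ≥0∞) *
        ∫⁻ x, ENNReal.ofReal ((quotientKernel 𝒢.quotientSubgroup ρ
          (mulConv ν (f : 𝒢.Adelic → ℂ) (mulStar f)) x x).re) ∂μ :=
    lintegral_lintegral_enorm_sq_quotientKernel_eq 𝒢.quotientSubgroup ρ μ ν (𝕜 := ℂ) hc
      (f := (f : 𝒢.Adelic → ℂ)) f.continuous f.hasCompactSupport
  rw [tsum_enorm_sq_integratedOperator_rightRegular_eq 𝒢 μ ρ ν hρ f b, h2, ← mul_assoc]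
  congr 1
  -- `ofReal (c⁻¹ ^ 2) * c = ofReal (c⁻¹)`
  rw [← ENNReal.ofReal_coe_nnreal, ← ENNReal.ofReal_mul (sq_nonneg _), sq, mul_assoc,
    inv_mul_cancel₀ hcpos.ne', mul_one]

end AdelicGroupData

end Literature.NumberTheory.Automorphic
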